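import Mathlib.Data.Finset.Card
import Mathlib.Data.Finset.Lattice.Fold
import Mathlib.Data.List.Chain
import Mathlib.Data.ENat.Lattice
import Literature.Computability.MetaComplexity.ResLin
import Literature.Computability.MetaComplexity.ResLinProofs
import Literature.Computability.MetaComplexity.RevResLin
import HarnessLib

/-!
# Clause space of resolution over parities Res(⊕): configuration-style refutations

The CLAUSE SPACE measure of Esteban–Torán and Alekhnovich–Ben-Sasson–Razborov–Wigderson, one proof
system up: for resolution over parities Res(⊕) (Itsykson–Sokolov; `Literature.Computability.
MetaComplexity.IsResLinRefutation` is the line-based formalisation) a refutation in the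
configuration format is a sequence of MEMORY CONFIGURATIONS — finite sets of linear clauses —
starting from the empty memory, each obtained from the previous one by

* Download: add (the translation of) a clause of the refuted CNF `φ`;
* Erasure: remove a clause from the memory;
* Inference: add the conclusion of ONE application of a rule of Res(⊕) — the resolution rule
  `C ∨ (f = 0), D ∨ (f = 1) ⊢ C ∨ D` or the SEMANTIC weakening rule `C ⊢ D` (`C ⊨ D`) — to premises
  currently in memory;

and ending in a configuration containing the empty clause. The clause space of the refutation is
the largest number of clauses simultaneously in memory; the clause space of `φ` is the minimum over
its refutations [Gryaznov–Ovcharov–Riazanov, ACM ToCT 2024, §2.4, verbatim the resolution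
definition of Esteban–Torán 2001 / ABRW 2002 Defs. 3.1–3.2 ("Inference. M_t := M_{t−1} ∪ {C}, for
some C obtained by a single application of the resolution rule to two clauses in M_{t−1}") with
linear clauses for clauses and the two rules of Res(⊕) for the resolution rule].

## Contents

* `ResLinSpaceStep φ M M'` (one memory operation), `IsResLinSpaceRefutation φ π`,
  `resLinClauseSpace π`, `minResLinClauseSpace φ : ℕ∞`.
* Soundness `not_satisfiable_of_isResLinSpaceRefutation` (every clause ever in memory is implied
  by `φ`).
* Compatibility with the line-based format: `exists_isResLinSpaceRefutation_of_isResLinRefutation`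
  (keep every line in memory: a refutation with `s` lines gives a configuration-style refutation of
  clause space `≤ s`), hence `minResLinClauseSpace_le_minResLinRefutationSize` — in particular the
  notion is inhabited exactly on refutable CNFs.
* The combinatorial objects of the space–width relation of [GOR 2024, §4] (winning strategies,
  clauses derivable within a given literal-width) are in `ResLinWinningStrategy.lean`; the relation
  itself (GOR Thm 6) in `ResLinSpaceWidth.lean`.

## Design notes

* A linear SYSTEM over `𝔽₂` is a `Finset LinLit`, the equation `(f, b)` meaning `⊕_{i∈f} xᵢ = b`;
  `σ` solves `F` iff `∀ e ∈ F, LinLit.eval σ e = true`. Literal-width of a linear clause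
  `C : LinClause = Finset LinLit` is `C.card` (GOR's width; the tree's `linClauseRank C ≤ C.card`,
  `linClauseRank_le_card`, is the basis-free variant).
* Inference adds ONE rule conclusion (premises must be in memory), exactly as in ABRW 2002 Def. 3.1
  ("a single application of the resolution rule"); erasing removes one clause at a time (ABRW erase
  subsets — immaterial for clause space) and requires membership; re-deriving a clause already in
  memory is a legal (idle) step.
* What is NOT here: total space / variable space; tree-like space; the Prover–Delayer and space
  games of [GOR 2024, §3]; PCR space.

## References

* S. Gryaznov, S. Ovcharov, A. Riazanov, *Resolution over linear equations: combinatorial games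
  for tree-like size and space*, ACM Trans. Comput. Theory 16(3) (2024), §2.4, §4
  [GryaznovOvcharovRiazanov2024].
* J. L. Esteban, J. Torán, *Space bounds for resolution*, Inform. Comput. 171 (2001) (the origin
  of the clause-space measure; conference version STACS 1999) [EstebanToran2001].
* M. Alekhnovich, E. Ben-Sasson, A. Razborov, A. Wigderson, *Space complexity in propositional
  calculus*, SIAM J. Comput. 31 (2002), Def. 3.1 (syntactical resolution derivation: download,
  memory erasing, inference by a single rule application), Def. 3.2 (clause space), Thm. 3.5
  (`CSpace ≤ n + 1`, after Esteban–Torán) [AlekhnovichBenSassonRazborovWigderson2002].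
-/

namespace Literature.Computability.MetaComplexity

open _root_.Computability Complexity

/-! ### Configuration-style refutations and clause space -/

/-- One memory operation of a configuration-style Res(⊕) refutation of `φ`
[Gryaznov–Ovcharov–Riazanov 2024, §2.4; ABRW 2002, Def. 3.1]: `download` a clause of `φ` (as a
linear clause), `erase` a clause present in memory, or add the conclusion of ONE inference from
premises in memory — `resolve`: from `C ∨ (f = 0)` and `D ∨ (f = 1)` the clause `C ∨ D`;
`weaken`: from `C` any linear clause `D` semantically implied by `C` (Itsykson–Sokolov's semantic
weakening rule). [cite: GryaznovOvcharovRiazanov2024, §2.4] -/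
inductive ResLinSpaceStep (φ : CNF ℕ) : Finset LinClause → Finset LinClause → Prop
  /-- Download: `M ↦ M ∪ {C}` for a clause `C` of `φ`. -/
  | download (M : Finset LinClause) (c : Clause ℕ) (hc : c ∈ φ) :
      ResLinSpaceStep φ M (insert (Clause.toLinClause c) M)
  /-- Erasure: `M ↦ M \ {C}` for `C ∈ M`. -/
  | erase (M : Finset LinClause) (C : LinClause) (hC : C ∈ M) :
      ResLinSpaceStep φ M (M.erase C)
  /-- Inference by the resolution rule from two premises in memory. -/
  | resolve (M : Finset LinClause) (C D : LinClause) (f : Finset ℕ)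
      (hC : insert (f, false) C ∈ M) (hD : insert (f, true) D ∈ M) :
      ResLinSpaceStep φ M (insert (C ∪ D) M)
  /-- Inference by the semantic weakening rule from a premise in memory. -/
  | weaken (M : Finset LinClause) (C D : LinClause) (hC : C ∈ M)
      (h : ∀ σ : ℕ → Bool, C.eval σ = true → D.eval σ = true) :
      ResLinSpaceStep φ M (insert D M)

/-- `π` is a configuration-style Res(⊕) refutation of `φ` [Gryaznov–Ovcharov–Riazanov 2024, §2.4]:
a nonempty sequence of memory configurations, the first one empty, consecutive ones related by one
memory operation, the last one containing the empty linear clause.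
[cite: GryaznovOvcharovRiazanov2024, §2.4] -/
def IsResLinSpaceRefutation (φ : CNF ℕ) (π : List (Finset LinClause)) : Prop :=
  ∃ hne : π ≠ [], π.head hne = ∅ ∧ List.IsChain (ResLinSpaceStep φ) π ∧
    (∅ : LinClause) ∈ π.getLast hne

/-- The CLAUSE SPACE of a sequence of configurations: the largest number of linear clauses
simultaneously in memory (`0` for the empty sequence). [Gryaznov–Ovcharov–Riazanov 2024, §2.4
(`Space(π) = maxᵢ |Sᵢ|`); ABRW 2002, Def. 3.2] [cite: GryaznovOvcharovRiazanov2024, §2.4] -/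
def resLinClauseSpace (π : List (Finset LinClause)) : ℕ :=
  (π.map Finset.card).foldr max 0

/-- The Res(⊕) CLAUSE SPACE of `φ`: the minimum clause space of a configuration-style Res(⊕)
refutation, in `ℕ∞` (`⊤` iff `φ` has none, i.e. iff `φ` is satisfiable).
[Gryaznov–Ovcharov–Riazanov 2024, §2.4 (`Space(φ) = min_π Space(π)`)]
[cite: GryaznovOvcharovRiazanov2024, §2.4] -/
noncomputable def minResLinClauseSpace (φ : CNF ℕ) : ℕ∞ :=
  ⨅ (π : List (Finset LinClause)) (_ : IsResLinSpaceRefutation φ π), (resLinClauseSpace π : ℕ∞)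

/-- `l.foldr max 0 ≤ n` iff every entry is `≤ n` (helper). [folklore] -/
private theorem foldr_max_zero_le_iff_cfg (l : List ℕ) (n : ℕ) :
    l.foldr max 0 ≤ n ↔ ∀ x ∈ l, x ≤ n := by
  induction l with
  | nil => simp
  | cons a l ih => simp [ih]

/-- The clause space is `≤ s` iff every configuration has at most `s` clauses. [folklore] -/
theorem resLinClauseSpace_le_iff {π : List (Finset LinClause)} {s : ℕ} :
    resLinClauseSpace π ≤ s ↔ ∀ M ∈ π, M.card ≤ s := by
  rw [resLinClauseSpace, foldr_max_zero_le_iff_cfg]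
  simp

/-- Every configuration has at most `resLinClauseSpace π` clauses. [folklore] -/
theorem card_le_resLinClauseSpace {π : List (Finset LinClause)} {M : Finset LinClause}
    (hM : M ∈ π) : M.card ≤ resLinClauseSpace π :=
  (resLinClauseSpace_le_iff.1 le_rfl) M hM

/-- `s < resLinClauseSpace π` iff some configuration has more than `s` clauses. [folklore] -/
theorem lt_resLinClauseSpace_iff {π : List (Finset LinClause)} {s : ℕ} :
    s < resLinClauseSpace π ↔ ∃ M ∈ π, s < M.card := by
  rw [← not_iff_not]
  push Not
  exact resLinClauseSpace_le_iff

/-- A refutation bounds the clause space of the formula. [folklore] -/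
theorem minResLinClauseSpace_le {φ : CNF ℕ} {π : List (Finset LinClause)}
    (h : IsResLinSpaceRefutation φ π) : minResLinClauseSpace φ ≤ resLinClauseSpace π :=
  iInf₂_le π h

/-- `s ≤ minResLinClauseSpace φ` iff every configuration-style refutation has clause space `≥ s`.
[folklore] -/
theorem le_minResLinClauseSpace_iff {φ : CNF ℕ} {s : ℕ} :
    (s : ℕ∞) ≤ minResLinClauseSpace φ ↔
      ∀ π, IsResLinSpaceRefutation φ π → s ≤ resLinClauseSpace π := by
  simp [minResLinClauseSpace, le_iInf_iff]

/-! ### Soundness: every clause ever in memory is implied by `φ` -/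

/-- One memory operation preserves "every clause in memory is true under `σ`" for a satisfying
assignment `σ` of `φ` (soundness of download, resolution and semantic weakening).
[Itsykson–Sokolov 2020, §2 (soundness of Res(⊕)); GOR 2024, §2.4] [cite: ItsyksonSokolov2020, §2] -/
theorem ResLinSpaceStep.eval_of_eval {φ : CNF ℕ} {M M' : Finset LinClause}
    (h : ResLinSpaceStep φ M M') {σ : ℕ → Bool} (hσ : φ.eval σ = true)
    (hM : ∀ C ∈ M, C.eval σ = true) : ∀ C ∈ M', C.eval σ = true := by
  cases h with
  | download c hc =>
      intro C hC
      rcases Finset.mem_insert.1 hC with rfl | hC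
      · rw [eval_toLinClause]
        have := (CNF.eval_eq_true_iff φ σ).1 hσ c hc
        simpa [Clause.eval] using this
      · exact hM C hC
  | erase C hC =>
      intro D hD
      exact hM D (Finset.mem_of_mem_erase hD)
  | resolve C D f hC hD =>
      intro E hE
      rcases Finset.mem_insert.1 hE with rfl | hE
      · have h0 := hM _ hC
        have h1 := hM _ hD
        rw [LinClause.eval_insert] at h0 h1
        rw [LinClause.eval_union]
        rw [LinLit.eval_true_eq_not] at h1
        revert h0 h1
        cases LinLit.eval σ (f, false) <;> cases LinClause.eval σ C <;>
          cases LinClause.eval σ D <;> simp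
      · exact hM E hE
  | weaken C D hC h =>
      intro E hE
      rcases Finset.mem_insert.1 hE with rfl | hE
      · exact h σ (hM C hC)
      · exact hM E hE

/-- **Soundness of configuration-style Res(⊕)**: a refuted CNF is unsatisfiable (a satisfying
assignment would satisfy every clause of every configuration, including the final empty clause).
[Gryaznov–Ovcharov–Riazanov 2024, §2.4; Itsykson–Sokolov 2020, §2] [cite: GryaznovOvcharovRiazanov2024, §2.4] -/
theorem not_satisfiable_of_isResLinSpaceRefutation {φ : CNF ℕ} {π : List (Finset LinClause)}
    (h : IsResLinSpaceRefutation φ π) : ¬ φ.Satisfiable := by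
  rintro ⟨σ, hσ⟩
  obtain ⟨hne, hhead, hchain, hlast⟩ := h
  have key : ∀ M ∈ π, ∀ C ∈ M, C.eval σ = true := by
    refine hchain.induction (fun M => ∀ C ∈ M, C.eval σ = true) π ?_ ?_
    · intro M M' hstep hM
      exact hstep.eval_of_eval hσ hM
    · intro _
      rw [hhead]
      simp
  have := key _ (List.getLast_mem hne) ∅ hlast
  simp [LinClause.eval] at this

/-! ### From line-based refutations: keep every line in memory -/

/-- The memory after the first `i` lines of a line-based derivation `π` have been derived and kept:
the set of their clauses. [ABRW 2002, Def. 3.1 ("comparing this definition with our previous one, we see they are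
equivalent in size"); Esteban–Torán 2001] [cite: AlekhnovichBenSassonRazborovWigderson2002, Def. 3.1] -/
def prefixConfig (π : List ResLinLine) (i : ℕ) : Finset LinClause :=
  ((π.take i).map ResLinLine.clause).toFinset

/-- Membership in `prefixConfig π i`: the clause of one of the first `i` lines. [folklore] -/
theorem mem_prefixConfig_iff {π : List ResLinLine} {i : ℕ} {C : LinClause} :
    C ∈ prefixConfig π i ↔ ∃ l ∈ π.take i, l.clause = C := by
  simp only [prefixConfig, List.mem_toFinset, List.mem_map]

/-- `prefixConfig π 0 = ∅`. [folklore] -/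
@[simp] theorem prefixConfig_zero (π : List ResLinLine) : prefixConfig π 0 = ∅ := by
  simp [prefixConfig]

/-- One more line: `prefixConfig π (i+1) = insert π[i].clause (prefixConfig π i)`. [folklore] -/
theorem prefixConfig_succ {π : List ResLinLine} {i : ℕ} (hi : i < π.length) :
    prefixConfig π (i + 1) = insert (π[i]'hi).clause (prefixConfig π i) := by
  ext C
  rw [Finset.mem_insert, mem_prefixConfig_iff, mem_prefixConfig_iff, List.take_succ_eq_append_getElem hi]
  simp only [List.mem_append, List.mem_singleton]
  constructor
  · rintro ⟨l, hl | rfl, rfl⟩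
    · exact Or.inr ⟨l, hl, rfl⟩
    · exact Or.inl rfl
  · rintro (rfl | ⟨l, hl, rfl⟩)
    · exact ⟨_, Or.inr rfl, rfl⟩
    · exact ⟨l, Or.inl hl, rfl⟩

/-- The configuration has at most `i ≤ |π|` clauses. [folklore] -/
theorem card_prefixConfig_le (π : List ResLinLine) (i : ℕ) :
    (prefixConfig π i).card ≤ π.length := by
  unfold prefixConfig
  refine le_trans (List.toFinset_card_le (l := (π.take i).map ResLinLine.clause)) ?_
  rw [List.length_map, List.length_take]
  exact min_le_right _ _

/-- A valid line of a line-based derivation is one memory operation on the prefix memory (its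
premises are in memory because nothing was erased). [ABRW 2002, Def. 3.1; Esteban–Torán 2001; GOR 2024, §2.4]
[cite: AlekhnovichBenSassonRazborovWigderson2002, Def. 3.1] -/
theorem resLinSpaceStep_prefixConfig {φ : CNF ℕ} {π : List ResLinLine}
    (hπ : IsResLinDerivation φ π) {i : ℕ} (hi : i < π.length) :
    ResLinSpaceStep φ (prefixConfig π i) (prefixConfig π (i + 1)) := by
  rw [prefixConfig_succ hi]
  have hvalid := hπ i hi
  unfold IsValidResLinLine at hvalid
  -- case on the rule of line `i`
  rcases hrule : (π[i]'hi).rule with _ | ⟨a, b, f⟩ | ⟨a⟩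
  · rw [hrule] at hvalid
    obtain ⟨c, hc, hcl⟩ := hvalid
    rw [hcl]
    exact ResLinSpaceStep.download _ c hc
  · rw [hrule] at hvalid
    obtain ⟨ha, hb, C, D, hCa, hDb, hcl⟩ := hvalid
    rw [hcl]
    refine ResLinSpaceStep.resolve _ C D f ?_ ?_
    · rw [mem_prefixConfig_iff]
      exact ⟨(π.take i)[a], List.getElem_mem ha, hCa⟩
    · rw [mem_prefixConfig_iff]
      exact ⟨(π.take i)[b], List.getElem_mem hb, hDb⟩
  · rw [hrule] at hvalid
    obtain ⟨ha, himp⟩ := hvalid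
    refine ResLinSpaceStep.weaken _ ((π.take i)[a]).clause _ ?_ himp
    rw [mem_prefixConfig_iff]
    exact ⟨(π.take i)[a], List.getElem_mem ha, rfl⟩

/-- **Line-based refutations are configuration-style refutations of clause space at most their
length**: derive the lines in order and never erase. [ABRW 2002, Def. 3.1; Esteban–Torán 2001; GOR 2024, §2.4]
[cite: AlekhnovichBenSassonRazborovWigderson2002, Def. 3.1] -/
theorem exists_isResLinSpaceRefutation_of_isResLinRefutation {φ : CNF ℕ} {π : List ResLinLine}
    (h : IsResLinRefutation φ π) :
    ∃ π' : List (Finset LinClause), IsResLinSpaceRefutation φ π' ∧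
      resLinClauseSpace π' ≤ π.length := by
  obtain ⟨hder, l, hl, hlcl⟩ := h
  refine ⟨(List.range (π.length + 1)).map (prefixConfig π), ?_, ?_⟩
  · have hne : (List.range (π.length + 1)).map (prefixConfig π) ≠ [] := by simp
    refine ⟨hne, ?_, ?_, ?_⟩
    · rw [List.head_map]
      have h0 : (List.range (π.length + 1)).head (by simp) = 0 := by
        simp [List.range_succ_eq_map, List.head_cons]
      rw [h0, prefixConfig_zero]
    · rw [List.isChain_map, List.isChain_iff_getElem]
      intro i hi
      simp only [List.length_range] at hi
      simp only [List.getElem_range]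
      exact resLinSpaceStep_prefixConfig hder (by omega)
    · rw [List.getLast_map, List.getLast_range (by simp)]
      simp only [Nat.add_one_sub_one]
      rw [mem_prefixConfig_iff, List.take_length]
      exact ⟨l, hl, hlcl⟩
  · rw [resLinClauseSpace_le_iff]
    intro M hM
    obtain ⟨i, -, rfl⟩ := List.mem_map.1 hM
    exact card_prefixConfig_le π i

/-- Consequently the clause space of `φ` is at most its minimal line-based refutation size; in
particular `minResLinClauseSpace φ < ⊤` for every refutable `φ`. [ABRW 2002, Def. 3.1; Esteban–Torán 2001]
[cite: AlekhnovichBenSassonRazborovWigderson2002, Def. 3.1] -/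
theorem minResLinClauseSpace_le_minResLinRefutationSize (φ : CNF ℕ) :
    minResLinClauseSpace φ ≤ minResLinRefutationSize φ := by
  unfold minResLinRefutationSize
  refine le_iInf₂ fun π hπ => ?_
  obtain ⟨π', hπ', hsp⟩ := exists_isResLinSpaceRefutation_of_isResLinRefutation hπ
  exact (minResLinClauseSpace_le hπ').trans (by exact_mod_cast hsp)

end Literature.Computability.MetaComplexity
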